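import Summits.Schanuel.Schanuel.Theorems.RootDecomp1KOnePointCell07
import Summits.Schanuel.Schanuel.Theorems.RootDecomp1KFiniteOrderCell04

/-!
# RootDecomp1KTHLayerCell — lens 1, generation 40 «THE (T.H.) LAYER OF 33364: ORDER GRADING + LIOUVILLE TRANSCENDENCE-TYPE MEASURE + DIAZ RUNGS ON THE MOMENT CURVE» — part 1 (RootDecomp1KTHLayerCell01): §1 order grading of 33364 by (T.H.) + §2 log-power lower bound ⇒ (T.H.)

PORT NOTE (census-1 gen 17, 2026-08-31): port of [HOME/decomp-schanuel-lens-1/g40/RootDecomp1KTHLayerCell.lean sha256 b5224e65…a9df, 1031 l + THprobe e690f2fc… + THctrl 205c2cec… + NODE-g40.md; NOTE/CLAIM L1860, NODE L1861 / REQUEST L1862 / RESULT L1863, writer re-check L1864, critic VERDICT L1866 (CLEARED; ONE THEOREM credit under K-R26's THEOREM lane — label NEW-COMBINATION-LOCAL «Diaz (T.H.) × Liouville log-power measure», the measure alone FOLKLORE-EFFECTIVISED; RULE K-R27: the (T.H.)/Diaz-rung line CLOSED for 33364 credit; port GO)]; own farm rc 0 · 0 warn · 0 sorry · axioms std.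
Split in five parts for the 400-line cap: 01 = §1 order grading (`Item33364`, `THLayer`, `PosLayer`, `UnderTH`, `item33364_iff_layers`, `thLayer_iff`, `thLayer_of_underTH`) + §2 `technicalHypothesis_of_logPow`; 02 = §3 the transcendence-type measure of `ℓ_b` (`measure_index`, `measure_logPow`); 03 = §4 (T.H.) / freeness / Liouville binders for the power tuples (`zpow`, `zC`, `zK`, `technicalHypothesis_zpow`, the named cell and the moment curves in the (T.H.)-layer scope); 04 = §5 Diaz rungs mod `LargeTranscendenceDegree` BY NAME + §6 the positive layer (`not_technicalHypothesis_zF`, `layers_proper`); 05 = §7 (PORT ADDITION, critic VERDICT L1866) the two `Iff.rfl` LIVE bridges P0/P0′ of the HOME probe + `thLayer_of_schanuelUnderTH` / `finiteOrderLiouvilleSchanuel_iff_layers` / `…_iff_posLayer_of_schanuelUnderTH` — the ONLY part importing `Theses.RootDecomp1K` / `Theses.DiophantineCore`.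
PORT EDITS: the three `set_option linter.*` lines dropped; eleven one-line docstrings added; `remainder_le_two_div` made private (statement-twin of the private tree helper `remainder_le'`); the unused binder `hdl` of `gridField_le_expMomentCurve` renamed `_hdl` (linter); four docstrings reworded per the VERDICT («REDUCED to 3816 — 3816 is OPEN, nothing decided», never «decided by 3816»); statements and proofs otherwise verbatim; the probes P1–P7 and the 21 axiom guards stay in the HOME probe. `--supports stmt-Schanuel-33364`; no census credit carried; nothing here proves Schanuel or 33364; rung 0. The lens's header follows.
-/

/-!
# RootDecomp1KTHLayerCell — decomp-schanuel lens 1 («grading / quantitative ladder»), generation 40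

**Node: the (T.H.) LAYER of `FiniteOrderLiouvilleSchanuel` (stmt-Schanuel-33364) — ORDER GRADING of the
residual and DIAZ RUNGS on the LIOUVILLE MOMENT CURVE.**

`F := FiniteOrderLiouvilleSchanuel` asks Schanuel's bound for every ℚ-free `z` that is linearly
Liouville but not hyper-linearly-Liouville.  Grade its domain by Diaz's *technical hypothesis*
(T.H.) `∀ ε > 0, |h·z| ≥ exp(−H^ε)` for `H ≥ H₀(ε)` (exponential order `0`):

* `F ⟺ F₊ ∧ F₀` (`item33364_iff_layers`), `F₀ := F ∧ (T.H.)` (= `THLayer`), `F₊ := F ∧ ¬(T.H.)`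
  (= `PosLayer`); on `F₀` the binder `¬HyperLinLiouville` is AUTOMATIC (`thLayer_iff`), and
  `F₀ ⟸ SchanuelUnderTH` (3816, Waldschmidt's Conjecture 2.3 = Schanuel under (T.H.); `thLayer_of_underTH`,
  spelled here as `UnderTH`; the probe file identifies it with the live 3816 decl).
* **New theorem (the input of a new TYPE for 33364): a hypothesis-free TRANSCENDENCE-TYPE MEASURE for the
  Liouville numbers `ℓ_b = Σ_k b^{−k!}` (`b ≥ 2`)** — `|P(ℓ_b)| ≥ ½·b^{−d·(k+d)!}` for every nonzero
  `P ∈ ℤ[X]` of degree `≤ d` and height `≤ H`, where `k ≥ d+1` is any index with `4(d+1)d2^d·H ≤ b^{k!}`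
  (`measure_index`; proof: among the `d+1` consecutive convergents `r_k,…,r_{k+d}`, `r_j = p_j/b^{j!}`, one is
  not a root of `P`, there `|P(r_j)| ≥ b^{−d·j!}` while `|P(ℓ_b) − P(r_j)| ≤ ½ b^{−d·j!}`), whence
  `|P(ℓ_b)| ≥ exp(−C_{b,d}(log H)^{d+2})` (`measure_logPow`, minimal `k`), whence **(T.H.) for every tuple of
  distinct powers of `ℓ_b`** (`technicalHypothesis_zpow`; U-numbers have transcendence type although no
  polynomial measure).  So the Liouville moment curves `zC b n = (ℓ_b, ℓ_b², …, ℓ_bⁿ)` — 33364's NAMED first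
  open cell is `zC b 2 = (ℓ_b, ℓ_b²)` (`liouvilleNumber_sq_cell`) — lie in the layer `F₀`
  (`momentCurve_mem_thLayer_scope`), are REDUCED to 3816 (`sb_momentCurve_of_underTH`; 3816 is OPEN — nothing is
  decided), and, hypothesis-free
  modulo Diaz's PROVED large-transcendence-degree theorem taken BY NAME
  (`hD : Literature.Barriers.Schanuel.LargeTranscendenceDegree`, discharged in the tree by
  `Literature.Barriers.Schanuel.LargeTranscendenceDegree_holds`), carry the **rung
  `⌈dl/(d+l)⌉ ≤ trdeg ℚ(zC b n, e^{zC b n})`, `n = d + l − 1`, `d + l < dl`** (`diazRung_momentCurve`):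
  `3 ≤ trdeg ℚ(ℓ_b^k, e^{ℓ_b^k} : 1 ≤ k ≤ 8)` (Schanuel: 8), `4 ≤ …(k ≤ 12)` (Schanuel: 12), and on the
  exponential side alone `3 ≤ trdeg ℚ(e^{ℓ_b}, e^{ℓ_b²}, …, e^{ℓ_b^{11}})` (`diazRung_exp_momentCurve`).
* Separation from every earlier cell of the lineage: all coordinates of `zC b n` are pairwise ALGEBRAICALLY
  DEPENDENT (no block of algebraically independent Liouville coordinates, no measured wall), and the input is
  E-side-free on the argument side: `ℓ_b` is Liouville, below every `log`-power floor of K-R22–K-R26.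

Kernel discipline: imports the TREE files `RootDecomp1KOnePointCell07` (the lineage chain) and
`RootDecomp1KFiniteOrderCell04` (tower numbers, §6) only (no `Theses` import is added —
the route file arrives transitively, its decls are NOT used here; the probe file applies the live items by
name); tree lemmas are used BY NAME (`liouvilleNumber_sq_cell`, `linLiouville_momentCurve`,
`transcendental_ofReal_of_liouville`, `not_technicalHypothesis_of_hyperLinLiouville`,
`liouvilleNumber_le`, `partialSum_pos'`, `zF_in_scope_33364`, `liouvilleOrder_ellF`, `ellF_pos`, `ellF_le_one`; the tail bound
`remainder_le_two_div` re-proves a private tree helper); Diaz's theorem enters as the hypothesis `hD` by name; 0 sorry.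

References: G. Diaz, *Grands degrés de transcendance pour des familles d'exponentielles*, J. Number Theory 31
(1989) 1–23 = Nesterenko–Philippon (eds.), LNM 1752 (2001), Ch. 14, Def. 2.6 / Thm 2.7 / Thm 2.9
[cite: NesterenkoPhilippon2001, Ch. 14 Thm 2.7]; M. Waldschmidt, Conjecture 2.3 ibid.;
J. Liouville (1844) / K. Mahler (1932) for the U-number `ℓ_b`; Y. Bugeaud, *Approximation by algebraic
numbers* (2004) §7 (Schmidt's invariant, LeVeque's Thm 7.4) for the print shape of transcendence measures of
Liouville numbers [cite: Bugeaud2004, Ch. 7].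
-/

noncomputable section

open Complex Polynomial IntermediateField Filter Asymptotics LiouvilleNumber
open scoped Nat Topology

namespace Summit.Schanuel.Schanuel.Theorems.RootDecomp1KTHLayer

open Summit.Schanuel.Schanuel.Theorems.RootDecomp1KHyper
open Summit.Schanuel.Schanuel.Theorems.RootDecomp1KHyper.HyperCell
open Summit.Schanuel.Schanuel.Theorems.RootDecomp1KGeneric (not_technicalHypothesis_of_hyperLinLiouville LiouvilleOrder)
open Summit.Schanuel.Schanuel.Theorems.RootDecomp1KFiniteOrderCell (zF ellF liouvilleOrder_ellF ellF_pos ellF_le_one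
  linearIndependent_zF linLiouville_zF not_hyperLinLiouville_zF zF_in_scope_33364)
open Summit.Schanuel.Schanuel.Theorems.RootDecomp1KTwoBaseCell (liouvilleNumber_le partialSum_pos')
open Literature.Barriers.Schanuel (TechnicalHypothesis LargeTranscendenceDegree gridField gridField₂ gridExp
  trdeg_mono one_le_of_add_lt_mul)

/-! ## §1 The order grading of the residual 33364 -/

/-- `FiniteOrderLiouvilleSchanuel` (stmt-Schanuel-33364), binders VERBATIM (the probe file proves
`Theses.RootDecomp1K.FiniteOrderLiouvilleSchanuel ↔ Item33364` by `Iff.rfl`). -/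
def Item33364 : Prop :=
  ∀ (n : ℕ) (z : Fin n → ℂ), LinearIndependent ℚ z →
    (∀ ω : ℕ, ∃ h : Fin n → ℤ, h ≠ 0 ∧ ‖∑ i, (h i : ℂ) * z i‖ < 1 / (1 + ∑ i, (|h i| : ℝ)) ^ ω) →
    (¬ ∀ m : ℕ, ∃ h : Fin n → ℤ, h ≠ 0 ∧
        ‖∑ i, (h i : ℂ) * z i‖ < Real.exp (-((1 + ∑ i, (|h i| : ℝ)) ^ m))) →
    (n : Cardinal) ≤ Algebra.trdeg ℚ
      ↥(IntermediateField.adjoin ℚ (Set.range z ∪ Set.range (Complex.exp ∘ z)))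

/-- **Layer `F₀` (exponential order `0`)**: 33364 restricted to tuples satisfying Diaz's (T.H.). -/
def THLayer : Prop :=
  ∀ (n : ℕ) (z : Fin n → ℂ), LinearIndependent ℚ z →
    (∀ ω : ℕ, ∃ h : Fin n → ℤ, h ≠ 0 ∧ ‖∑ i, (h i : ℂ) * z i‖ < 1 / (1 + ∑ i, (|h i| : ℝ)) ^ ω) →
    (¬ ∀ m : ℕ, ∃ h : Fin n → ℤ, h ≠ 0 ∧
        ‖∑ i, (h i : ℂ) * z i‖ < Real.exp (-((1 + ∑ i, (|h i| : ℝ)) ^ m))) →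
    TechnicalHypothesis z →
    (n : Cardinal) ≤ Algebra.trdeg ℚ
      ↥(IntermediateField.adjoin ℚ (Set.range z ∪ Set.range (Complex.exp ∘ z)))

/-- **Layer `F₊` (positive finite exponential order)**: 33364 restricted to tuples VIOLATING (T.H.). -/
def PosLayer : Prop :=
  ∀ (n : ℕ) (z : Fin n → ℂ), LinearIndependent ℚ z →
    (∀ ω : ℕ, ∃ h : Fin n → ℤ, h ≠ 0 ∧ ‖∑ i, (h i : ℂ) * z i‖ < 1 / (1 + ∑ i, (|h i| : ℝ)) ^ ω) →
    (¬ ∀ m : ℕ, ∃ h : Fin n → ℤ, h ≠ 0 ∧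
        ‖∑ i, (h i : ℂ) * z i‖ < Real.exp (-((1 + ∑ i, (|h i| : ℝ)) ^ m))) →
    ¬ TechnicalHypothesis z →
    (n : Cardinal) ≤ Algebra.trdeg ℚ
      ↥(IntermediateField.adjoin ℚ (Set.range z ∪ Set.range (Complex.exp ∘ z)))

/-- `SchanuelUnderTH` (stmt-Schanuel-3816 = Waldschmidt's Conjecture 2.3) in the spelling of
`Literature.Barriers.Schanuel.TechnicalHypothesis` (the probe file proves it `↔` the live 3816 decl by
`Iff.rfl`: 3816 inlines (T.H.); its source text `(|h i| : ℝ)` elaborates to `|(h i : ℝ)|`). -/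
def UnderTH : Prop :=
  ∀ (n : ℕ) (z : Fin n → ℂ), LinearIndependent ℚ z → TechnicalHypothesis z →
    (n : Cardinal) ≤ Algebra.trdeg ℚ
      ↥(IntermediateField.adjoin ℚ (Set.range z ∪ Set.range (Complex.exp ∘ z)))

/-- **The grading is exhaustive: `F ⟺ F₊ ∧ F₀`** (excluded middle on (T.H.)). -/
theorem item33364_iff_layers : Item33364 ↔ PosLayer ∧ THLayer := by
  constructor
  · intro hF
    exact ⟨fun n z hli hL hH _ => hF n z hli hL hH, fun n z hli hL hH _ => hF n z hli hL hH⟩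
  · rintro ⟨hP, hT⟩ n z hli hL hH
    by_cases h : TechnicalHypothesis z
    · exact hT n z hli hL hH h
    · exact hP n z hli hL hH h

/-- On the layer `F₀` the binder `¬HyperLinLiouville` is automatic: (T.H.) excludes hyper-linear-Liouville
relations (tree: `not_technicalHypothesis_of_hyperLinLiouville`). -/
theorem thLayer_iff :
    THLayer ↔ ∀ (n : ℕ) (z : Fin n → ℂ), LinearIndependent ℚ z →
      (∀ ω : ℕ, ∃ h : Fin n → ℤ, h ≠ 0 ∧ ‖∑ i, (h i : ℂ) * z i‖ < 1 / (1 + ∑ i, (|h i| : ℝ)) ^ ω) →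
      TechnicalHypothesis z →
      (n : Cardinal) ≤ Algebra.trdeg ℚ
        ↥(IntermediateField.adjoin ℚ (Set.range z ∪ Set.range (Complex.exp ∘ z))) := by
  constructor
  · intro hT n z hli hL hth
    exact hT n z hli hL (fun hH => not_technicalHypothesis_of_hyperLinLiouville hH hth) hth
  · intro h n z hli hL _ hth
    exact h n z hli hL hth

/-- **Edge `F₀ ⟸ 3816`**: Schanuel under (T.H.) implies the whole order-`0` layer (a REDUCTION to the OPEN item 3816). -/
theorem thLayer_of_underTH (hU : UnderTH) : THLayer :=
  fun n z hli _ _ hth => hU n z hli hth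

/-- The hyper cells (`HyperLinLiouville`, the scope of 33363) lie in NEITHER layer's scope: they violate the
`¬Hyper` binder; and they violate (T.H.) as well. -/
theorem hyper_not_in_layers {n : ℕ} {z : Fin n → ℂ} (hz : HyperLinLiouville z) :
    ¬ TechnicalHypothesis z ∧ ¬ ¬ (∀ m : ℕ, ∃ h : Fin n → ℤ, h ≠ 0 ∧
        ‖∑ i, (h i : ℂ) * z i‖ < Real.exp (-((1 + ∑ i, (|h i| : ℝ)) ^ m))) :=
  ⟨not_technicalHypothesis_of_hyperLinLiouville hz, fun h => h hz⟩

/-! ## §2 A log-power lower bound implies (T.H.) -/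

/-- **Transcendence type implies (T.H.).** If `‖Σ hᵢuᵢ‖ ≥ exp(−C·(log(3 + Σ|hᵢ|))^m)` for every nonzero
`h ∈ ℤⁿ` (`C ≥ 0`), then `u` satisfies Diaz's technical hypothesis: `(log H)^m = o(H^ε)`. [folklore;
NesterenkoPhilippon2001 Ch. 14, remark after Def. 2.6] -/
theorem technicalHypothesis_of_logPow {n : ℕ} {u : Fin n → ℂ} {C : ℝ} (hC : 0 ≤ C) {m : ℕ}
    (hlb : ∀ h : Fin n → ℤ, h ≠ 0 →
      Real.exp (-(C * Real.log (3 + ∑ i, |(h i : ℝ)|) ^ m)) ≤ ‖∑ i, (h i : ℂ) * u i‖) :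
    TechnicalHypothesis u := by
  intro ε hε
  set A : ℝ := (n : ℝ) + 3 with hA
  have hn0 : (0 : ℝ) ≤ n := Nat.cast_nonneg n
  have hA3 : 3 ≤ A := by rw [hA]; linarith
  have hA0 : 0 < A := by linarith
  set c : ℝ := 1 / ((C + 1) * 2 ^ m) with hc
  have hden : (0 : ℝ) < (C + 1) * 2 ^ m := by positivity
  have hc0 : 0 < c := by rw [hc]; positivity
  have hev : ∀ᶠ x : ℝ in atTop, ‖Real.log x ^ (m : ℝ)‖ ≤ c * ‖x ^ ε‖ :=
    (isLittleO_log_rpow_rpow_atTop (m : ℝ) hε).bound hc0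
  obtain ⟨H₁, hH₁⟩ := eventually_atTop.mp hev
  refine ⟨max A H₁, lt_of_lt_of_le hA0 (le_max_left _ _), fun H hH h hh hle => ?_⟩
  have hAH : A ≤ H := (le_max_left _ _).trans hH
  have hH1 : 1 ≤ H := by linarith
  have hH0 : 0 < H := by linarith
  set S : ℝ := ∑ i, |(h i : ℝ)| with hS
  have hS0 : 0 ≤ S := Finset.sum_nonneg fun i _ => abs_nonneg _
  have hSle : S ≤ n * H := by
    calc S ≤ ∑ _i : Fin n, H := Finset.sum_le_sum fun i _ => hle i
      _ = n * H := by rw [Finset.sum_const, Finset.card_univ, Fintype.card_fin, nsmul_eq_mul]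
  have hAH' : A * H = n * H + 3 * H := by rw [hA]; ring
  have h3S : 3 + S ≤ A * H := by rw [hAH']; linarith
  have h3S0 : 0 < 3 + S := by linarith
  have hlogH : 0 ≤ Real.log H := Real.log_nonneg hH1
  have hlogA : Real.log A ≤ Real.log H := Real.log_le_log hA0 hAH
  have hlog3S : Real.log (3 + S) ≤ 2 * Real.log H := by
    calc Real.log (3 + S) ≤ Real.log (A * H) := Real.log_le_log h3S0 h3S
      _ = Real.log A + Real.log H := Real.log_mul hA0.ne' hH0.ne'
      _ ≤ 2 * Real.log H := by linarith
  have hlog3S0 : 0 ≤ Real.log (3 + S) := Real.log_nonneg (by linarith)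
  have hmain := hH₁ H ((le_max_right _ _).trans hH)
  have hnorm1 : ‖Real.log H ^ (m : ℝ)‖ = Real.log H ^ m := by
    rw [Real.rpow_natCast, Real.norm_eq_abs, abs_of_nonneg (pow_nonneg hlogH _)]
  have hnorm2 : ‖H ^ ε‖ = H ^ ε := by
    rw [Real.norm_eq_abs, abs_of_nonneg (Real.rpow_nonneg hH0.le _)]
  rw [hnorm1, hnorm2] at hmain
  have hHε : 0 ≤ H ^ ε := Real.rpow_nonneg hH0.le _
  have key : C * Real.log (3 + S) ^ m ≤ H ^ ε := by
    have h1 : Real.log (3 + S) ^ m ≤ (2 * Real.log H) ^ m := pow_le_pow_left₀ hlog3S0 hlog3S m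
    have h2 : C * 2 ^ m * Real.log H ^ m ≤ (C + 1) * 2 ^ m * (c * H ^ ε) :=
      mul_le_mul (by nlinarith [pow_nonneg (zero_le_two : (0:ℝ) ≤ 2) m]) hmain
        (pow_nonneg hlogH _) (by positivity)
    calc C * Real.log (3 + S) ^ m ≤ C * (2 * Real.log H) ^ m := mul_le_mul_of_nonneg_left h1 hC
      _ = C * 2 ^ m * Real.log H ^ m := by rw [mul_pow]; ring
      _ ≤ (C + 1) * 2 ^ m * (c * H ^ ε) := h2
      _ = H ^ ε := by rw [hc, one_div, ← mul_assoc, mul_inv_cancel₀ hden.ne', one_mul]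
  calc Real.exp (-(H ^ ε)) ≤ Real.exp (-(C * Real.log (3 + S) ^ m)) :=
        Real.exp_le_exp.mpr (by linarith)
    _ ≤ ‖∑ i, (h i : ℂ) * u i‖ := hlb h hh

end Summit.Schanuel.Schanuel.Theorems.RootDecomp1KTHLayer

end
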